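import Mathlib.RingTheory.SimpleModule.Basic
import Mathlib.Algebra.Algebra.Subalgebra.Lattice
import Literature.AlgebraicGeometry.Motives.TateAbelianFiniteLattice
import Literature.AlgebraicGeometry.Motives.AbelianVarietyProduct
import Literature.AlgebraicGeometry.Motives.AbelianVarietyIsogenyProofs
import HarnessLib

/-!
# Tate 1966, Main Theorem in `End` form: the reductions around the lattice lemma

Sibling file (theorems only) of `Literature.AlgebraicGeometry.Motives.TateAbelianFinite`, which
vendors Tate's Main Theorem (J. Tate, *Endomorphisms of abelian varieties over finite fields*,
Invent. Math. 2 (1966), 134–144: for abelian varieties `A, B` over a finite field `k` and a prime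
`ℓ ≠ char k` the map `ℤ_ℓ ⊗ Hom_k(A, B) → Hom_Γ(T_ℓ A, T_ℓ B)` is bijective) as the named facts
`tate_bijective_of_finite A B ℓ` (`Hom` form) and `tate_end_bijective_of_finite A ℓ` (`End`
form), and fourth file of the decomposition of their proof along the printed argument
(`TateAbelianFiniteSteps`: the graph argument; `TateLatticeLimitProofs`: `ℓ`-adic compactness;
`TateAbelianFiniteLattice`: the lattice lemma `tateSubspaceRealization P ℓ` over a finite field
from the finiteness of isomorphism classes and quotient isogenies).

Tate's paper is not held by the project; the architecture is that of the detailed account in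
J. Kieffer, *Isogeny graphs of abelian varieties over finite fields* (2024), §1.2.4, pp. 26–32
(held, read) and of J. S. Milne, *The Work of John Tate*, §4.3.1 (arXiv:1210.7459, pp. 22–23;
held, read). This file proves two of its steps outright and assembles a third:

1. **`Hom` from `End`** (Kieffer, Prop. 1.2.20, p. 28: "Apply Tate's theorem to `End(A × B)`";
   Milne §4.3.1: "It suffices to prove the statement with `A = B`"; Faltings 1983, §5, proof of
   Korollar 1): for a bicone `b` of `(A, B)` (a biproduct `A ⊞ B`, which exists:
   `AbelianVarietyProduct`), bijectivity of the Tate map for `End_K(b.pt)` gives bijectivity for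
   `Hom_K(A, B)` — `tate_bijective_of_finite_of_end`, `tate_bijective_of_finite_of_forall_end`,
   at the level of `ℤ_ℓ ⊗ Hom → Hom_Γ(T_ℓ A, T_ℓ B)` (`AbelianVariety.faltingsTateMap`). Both
   halves are transported through the corner maps `f ↦ b.fst ≫ f ≫ b.inr`,
   `φ ↦ b.inl ≫ φ ≫ b.snd` (whose composite is the identity of `Hom_K(A, B)`) and functoriality
   of `T_ℓ`.
2. **The double-centraliser step, `ℚ_ℓ`-form of the Main Theorem for `End`** (Kieffer,
   Lemmas 1.2.24–1.2.26, pp. 31–32; Tate §2). Kieffer (following Tate) realises maximal isotropic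
   `Γ_k`-stable subspaces only, at a prime `ℓ` where Frobenius is split, and climbs down to lines
   through orthogonal complements. The tree's lattice lemma is the *strong* form (every
   `Γ_k`-stable subspace of `V_ℓ P` is `u(V_ℓ P)` with `u ∈ E_ℓ(P)`, Kieffer Remark 1.2.18), which
   allows the following polarisation-free and Frobenius-free route, proved here for an arbitrary
   field `K`:
   * `comp_eq_comp_of_tateSubspaceRealization` (**graph commutation**): if the lattice lemma holds
     for a biproduct `b.pt = A ⊞ A`, then every `d ∈ End_{ℚ_ℓ}(V_ℓ A)` commuting with all
     `V_ℓ φ`, `φ ∈ End_K(A)` — i.e. `d` in the centraliser `D` of `E_ℓ(A)` — commutes with every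
     `Γ_K`-equivariant `x ∈ End_{ℚ_ℓ}(V_ℓ A)`: the diagonal `d ⊕ d` centralises `E_ℓ(A ⊞ A)`, hence
     stabilises the graph of `x` (a `Γ_K`-stable subspace, so of the form `u(V_ℓ(A ⊞ A))`,
     `u ∈ E_ℓ(A ⊞ A)`), and `(d v, d (x v)) ∈ graph(x)` reads `x (d v) = d (x v)`;
   * `mem_rationalEndSpanAV_of_forall_comp_eq` (**Jacobson density**): if `E_ℓ(A)` is a
     semisimple ring and `V_ℓ A` is finite-dimensional, an `x` commuting with the centraliser of
     `E_ℓ(A)` lies in `E_ℓ(A)` (Mathlib `jacobson_density` for the semisimple `E_ℓ(A)`-module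
     `V_ℓ A`; this is the double centraliser theorem, Kieffer Prop. 1.2.26 citing Milne CFT
     Thm. 1.14);
   * `mem_rationalEndSpanAV_iff_of_tateSubspaceRealization`: hence, under the lattice lemma for
     `A ⊞ A`, semisimplicity of `E_ℓ(A)` and finiteness of `T_ℓ A`,
     `E_ℓ(A) = End_{Γ_K}(V_ℓ A)` — bijectivity of Tate's map `(3)`
     `ℚ_ℓ ⊗ End_K(A) → End_Γ(V_ℓ A)` onto its image side (Kieffer Prop. 1.2.26).
3. **Over a finite field** (`mem_rationalEndSpanAV_iff_of_finite`): with the tree's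
   `tateSubspaceRealization_of_finite_of_quotient` the `ℚ_ℓ`-form of the Main Theorem for
   `End_K(A)`, `K` finite, `(ℓ : K) ≠ 0`, follows from the named facts
   `AbelianVariety.finite_isoClasses_of_finite` (Milne 1986, Cor. 18.9),
   `AbelianVariety.exists_quotient_isogeny` (Kieffer Prop. 1.1.10–1.1.13),
   `AbelianVariety.module_free_tateModule`, `module_finite_tateModule` (Mumford §19) — all taken as
   hypotheses — and the semisimplicity hypothesis `hss` below.
4. **Integral form** (`exists_ne_zero_smul_mem_span_of_baseChange_mem_rationalEndSpanAV`,
   `…_of_equivariant_of_finite`): clearing denominators (`ℚ_ℓ = Frac ℤ_ℓ`, `T_ℓ A ↪ V_ℓ A`), every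
   `Γ_K`-equivariant `ℤ_ℓ`-linear endomorphism of `T_ℓ A` has a non-zero `ℤ_ℓ`-multiple in the
   `ℤ_ℓ`-span of the `T_ℓ φ`, `φ ∈ End_K(A)` (Tate §1, (3) ⇒ multiples in (1); Kieffer
   Prop. 1.2.21–1.2.22).
5. **Assembly** (`tate_end_bijective_of_finite_of_saturated`): the named fact
   `tate_end_bijective_of_finite A ℓ` follows from the hypotheses of item 3 for `A ⊞ A` together
   with the injectivity `AbelianVariety.faltingsTateMap_injective A A` (Mumford §19 Thm. 3) and
   the saturation of `ℤ_ℓ · End_K(A)` in `End(T_ℓ A)` (torsion-free cokernel: Tate §1 Lemma 1,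
   Milne 1986 Thm. 12.5, Kieffer Prop. 1.2.21), both taken as hypotheses — an exact statement of
   what separates the tree from a discharge of the named fact.

## The semisimplicity input

The double centraliser theorem needs `E_ℓ(A)` — the `ℚ_ℓ`-subalgebra of `End_{ℚ_ℓ}(V_ℓ A)`
generated (equivalently, by `toSubmodule_adjoin_eq_rationalEndSpanAV`, spanned) by the `V_ℓ φ`,
`φ ∈ End_K(A)` — to be semisimple. In the sources this is Poincaré's complete reducibility
theorem in the form "`End⁰(A) = ℚ ⊗ End_K(A)` is a finite-dimensional semisimple `ℚ`-algebra"
(Mumford, *Abelian Varieties*, §19, Cor. 2 of Thm. 1, p. 174) followed by extension of scalars to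
`ℚ_ℓ` (Kieffer p. 32: "since `End(A) ⊗ ℚ_ℓ` is a semisimple `ℚ_ℓ`-algebra, we conclude by the
double centralizer theorem"). The tree has no such named fact and this file does not introduce
one (D-0026): semisimplicity enters as the hypothesis
`hss : IsSemisimpleRing ↥(Algebra.adjoin ℚ_[ℓ] (Set.range (V_ℓ ·)))`, which is implied by the
printed statement since `E_ℓ(A)` is a quotient of `ℚ_ℓ ⊗ End_K(A)`.

## What is *not* done here

No `_holds` theorem is claimed: the inputs of item 5 — the named facts
`finite_isoClasses_of_finite`, `exists_quotient_isogeny`, `module_free_tateModule`,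
`module_finite_tateModule`, `faltingsTateMap_injective` (all undischarged for abelian varieties),
the semisimplicity of `E_ℓ(A)` (Poincaré reducibility; no named fact in the tree) and the
saturation step (which rests on the isogeny `[ℓ]` and the universal property of the quotient
`A → A/A[ℓ]`; Kieffer Prop. 1.1.12 and 1.2.21) — are genuine theorems of the theory of abelian
varieties, not proved here.

## References

* [Tate1966Endomorphisms] J. Tate, *Endomorphisms of abelian varieties over finite fields*,
  Invent. Math. 2 (1966), 134–144: Main Theorem; §2. Not held; architecture as reported below.
* [Kieffer2024IsogenyGraphs] J. Kieffer, *Isogeny graphs of abelian varieties over finite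
  fields* (2024), §1.2.4: Thm. 1.2.11 (p. 26), Rem. 1.2.18 (p. 27), Prop. 1.2.20 (p. 28),
  Lemma 1.2.23 (p. 30), Lemmas 1.2.24–1.2.25 and Prop. 1.2.26 (pp. 31–32). Held
  (`paper:galaxy-pdf-6943401066381083540`), read.
* [Milne2013WorkOfTate] J. S. Milne, *The Work of John Tate*, §4.3 and §4.3.1 (arXiv:1210.7459,
  pp. 22–23). Held, read.
* [Faltings1986FinitenessTranslation] G. Faltings, *Finiteness theorems for abelian varieties
  over number fields*, in Cornell–Silverman, *Arithmetic Geometry* (1986), Ch. II, §5, Theorem 4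
  and Corollary 1 ("Theorem 4 applied to `A₁ × A₂`"), pp. 22–23 (PDF pp. 89–90; held, read).
* [MumfordAV1970] D. Mumford, *Abelian Varieties*, §19: Thm. 3 (injectivity), Cor. 2 of Thm. 1
  (semisimplicity of `End⁰`). Not held.

## Design

Theorems only; `noncomputable section`; `namespace Literature.AlgebraicGeometry.Motives`;
universe-monomorphic `K : Type u`. Biproducts enter as explicit bicone data
`(b : BinaryBicone A B)` with the identities they need (`b.inl_fst`, …, and the total identity
`hb` only where used), exactly as in `TateAbelianFiniteSteps`; the instance
`HasBinaryBiproducts (AbelianVariety K)` of `AbelianVarietyProduct` supplies them in the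
corollaries (`BinaryBiproduct.bicone`, `biprod.total`). Mathlib used: `jacobson_density`,
`Subalgebra.moduleLeft`, `Algebra.adjoin_eq_span_of_subset`, `LinearMap.ext_on`,
`LinearMap.lTensor`, `Representation.IntertwiningMap`, `Finsupp.mem_span_range_iff_exists_finsupp`,
`IsLocalization.exist_integer_multiples`; from the tree `TateModule.toRational_injective`,
`tateSubspaceRealization_of_finite_of_quotient`, `dim_eq_of_isIsogenous_holds`. Identities that
cross the type synonym `rationalTateModule` are proved pointwise on `1 ⊗ t` (as in
`TateAbelianFiniteSteps`), and `Finsupp.mem_span_range_iff_exists_finsupp` is given its ambient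
module explicitly for the same reason.
-/

noncomputable section

universe u

open CategoryTheory CategoryTheory.Limits
open scoped TensorProduct

namespace Literature.AlgebraicGeometry.Motives

open AbelianVariety

variable {K : Type u} [Field K]

/-! ## `E_ℓ(A)`: the span of the `V_ℓ φ` is a subalgebra commuting with `Γ_K` -/

section RationalEndSpan

variable (A : AbelianVariety K) (ℓ : ℕ) [Fact ℓ.Prime]

/-- `1 = V_ℓ(𝟙 A) ∈ E_ℓ(A)`. [folklore] -/
theorem one_mem_rationalEndSpanAV :
    (1 : Module.End ℚ_[ℓ] (A.rationalTateModule ℓ)) ∈ rationalEndSpanAV A ℓ := by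
  have h := rationalTateModuleMap_mem_rationalEndSpanAV A ℓ (𝟙 A)
  rwa [rationalTateModuleMap_id] at h

variable {A} in
/-- `E_ℓ(A)` is closed under composition: `V_ℓ φ ∘ V_ℓ ψ = V_ℓ (ψ ≫ φ)` on generators, and
bilinearity of composition. [folklore] -/
theorem mul_mem_rationalEndSpanAV {u v : Module.End ℚ_[ℓ] (A.rationalTateModule ℓ)}
    (hu : u ∈ rationalEndSpanAV A ℓ) (hv : v ∈ rationalEndSpanAV A ℓ) :
    u * v ∈ rationalEndSpanAV A ℓ := by
  induction hu using Submodule.span_induction generalizing v with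
  | mem u hu' =>
    obtain ⟨φ, rfl⟩ := hu'
    induction hv using Submodule.span_induction with
    | mem v hv' =>
      obtain ⟨ψ, rfl⟩ := hv'
      have : (rationalTateModuleMap ℓ φ : Module.End ℚ_[ℓ] (A.rationalTateModule ℓ)) *
          rationalTateModuleMap ℓ ψ = rationalTateModuleMap ℓ (ψ ≫ φ) := by
        rw [Module.End.mul_eq_comp, ← rationalTateModuleMap_comp]
      rw [this]
      exact rationalTateModuleMap_mem_rationalEndSpanAV A ℓ (ψ ≫ φ)
    | zero => rw [mul_zero]; exact zero_mem _
    | add v w _ _ hv hw => rw [mul_add]; exact add_mem hv hw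
    | smul c v _ hv => rw [mul_smul_comm]; exact Submodule.smul_mem _ c hv
  | zero => rw [zero_mul]; exact zero_mem _
  | add u u' _ _ hu hu' => rw [add_mul]; exact add_mem (hu hv) (hu' hv)
  | smul c u _ hu => rw [smul_mul_assoc]; exact Submodule.smul_mem _ c (hu hv)

/-- **`E_ℓ(A)` as a subalgebra.** The `ℚ_ℓ`-subalgebra of `End_{ℚ_ℓ}(V_ℓ A)` generated by the
`V_ℓ φ`, `φ ∈ End_K(A)`, has underlying submodule the span `rationalEndSpanAV A ℓ` of the `V_ℓ φ`
(the generators form a multiplicative family containing `1`; Mathlib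
`Algebra.adjoin_eq_span_of_subset`). Both are "the image of `End_K(A) ⊗ ℚ_ℓ` in `End(V_ℓ A)`"
(Tate's `E_ℓ`; Kieffer 2024, §1.2.4, `V_ℓ(End(A) ⊗ ℚ_ℓ)`). [folklore] -/
theorem toSubmodule_adjoin_eq_rationalEndSpanAV :
    Subalgebra.toSubmodule (Algebra.adjoin ℚ_[ℓ] (Set.range fun φ : A ⟶ A ↦
      (rationalTateModuleMap ℓ φ : Module.End ℚ_[ℓ] (A.rationalTateModule ℓ)))) =
      rationalEndSpanAV A ℓ := by
  rw [rationalEndSpanAV_def]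
  apply Algebra.adjoin_eq_span_of_subset
  -- the span is multiplicatively closed and contains `1`, hence contains the monoid closure
  let M : Submonoid (Module.End ℚ_[ℓ] (A.rationalTateModule ℓ)) :=
    { carrier := (rationalEndSpanAV A ℓ : Set (Module.End ℚ_[ℓ] (A.rationalTateModule ℓ)))
      one_mem' := one_mem_rationalEndSpanAV A ℓ
      mul_mem' := fun hu hv ↦ mul_mem_rationalEndSpanAV ℓ hu hv }
  have hle : Submonoid.closure (Set.range fun φ : A ⟶ A ↦
      (rationalTateModuleMap ℓ φ : Module.End ℚ_[ℓ] (A.rationalTateModule ℓ))) ≤ M :=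
    Submonoid.closure_le.mpr fun _ hx ↦ Submodule.subset_span hx
  intro x hx
  exact hle hx

variable {A} in
/-- Membership in the subalgebra `E_ℓ(A)` is membership in the span `rationalEndSpanAV A ℓ`.
[folklore] -/
theorem mem_adjoin_iff_mem_rationalEndSpanAV (x : Module.End ℚ_[ℓ] (A.rationalTateModule ℓ)) :
    x ∈ Algebra.adjoin ℚ_[ℓ] (Set.range fun φ : A ⟶ A ↦
      (rationalTateModuleMap ℓ φ : Module.End ℚ_[ℓ] (A.rationalTateModule ℓ))) ↔
      x ∈ rationalEndSpanAV A ℓ := by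
  rw [← Subalgebra.mem_toSubmodule, toSubmodule_adjoin_eq_rationalEndSpanAV]

variable {A} in
/-- Every element of `E_ℓ(A)` is `Γ_K`-equivariant (each `V_ℓ φ` is,
`rationalTateRep_rationalTateModuleMap`; Mumford §19, p. 176: `End_K(A)` lands in the
`Γ_K`-invariants). This is the trivial inclusion `E_ℓ(A) ⊆ End_Γ(V_ℓ A)` of Tate's theorem.
[folklore] -/
theorem apply_rationalTateRep_of_mem_rationalEndSpanAV
    {u : Module.End ℚ_[ℓ] (A.rationalTateModule ℓ)} (hu : u ∈ rationalEndSpanAV A ℓ)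
    (σ : Field.absoluteGaloisGroup K) (v : A.rationalTateModule ℓ) :
    u (A.rationalTateRep ℓ σ v) = A.rationalTateRep ℓ σ (u v) := by
  induction hu using Submodule.span_induction generalizing v with
  | mem u hu' =>
    obtain ⟨φ, rfl⟩ := hu'
    exact rationalTateRep_rationalTateModuleMap ℓ φ σ v
  | zero => simp only [LinearMap.zero_apply, map_zero]
  | add u u' _ _ hu hu' => simp only [LinearMap.add_apply, map_add, hu, hu']
  | smul c u _ hu => simp only [LinearMap.smul_apply, map_smul, hu]

end RationalEndSpan

/-! ## Graph commutation: the centraliser of `E_ℓ(A)` commutes with `End_Γ(V_ℓ A)` -/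

section GraphCommutation

variable {A : AbelianVariety K} (ℓ : ℕ) [Fact ℓ.Prime]

/-- **Graph commutation** (Tate 1966, §2; on the route of Kieffer 2024, Lemmas 1.2.24–1.2.25,
with the strong lattice lemma of Remark 1.2.18 in place of isotropic subspaces and Frobenius
eigenlines). Let `b` be a bicone of `(A, A)` with `b.fst ≫ b.inl + b.snd ≫ b.inr = 𝟙` (a biproduct
`A ⊞ A`) and assume Tate's lattice lemma for `b.pt` at `ℓ` (`hW : tateSubspaceRealization b.pt ℓ`:
every `Γ_K`-stable subspace of `V_ℓ(b.pt)` is `u(V_ℓ b.pt)` for some `u ∈ E_ℓ(b.pt)`). If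
`d ∈ End_{ℚ_ℓ}(V_ℓ A)` commutes with every `V_ℓ φ`, `φ ∈ End_K(A)`, and `x ∈ End_{ℚ_ℓ}(V_ℓ A)` is
`Γ_K`-equivariant, then `d ∘ x = x ∘ d`. Proof: the diagonal
`d_P = V(inl) d V(fst) + V(inr) d V(snd)` commutes with every `V_ℓ φ`, `φ ∈ End_K(b.pt)` (compare
the four corners `V(pr_i) ∘ – ∘ V(in_j)`, which for `V_ℓ φ` are the `V_ℓ(in_j ≫ φ ≫ pr_i)`,
endomorphisms of `A`), hence with `E_ℓ(b.pt)`, hence stabilises the graph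
`W = {V(inl) v + V(inr) (x v)} = u(V_ℓ b.pt)` of `x`; and `d_P (V(inl) v + V(inr)(x v)) =
V(inl)(d v) + V(inr)(d (x v)) ∈ W` says `x (d v) = d (x v)`. [folklore] -/
theorem comp_eq_comp_of_tateSubspaceRealization (b : BinaryBicone A A)
    (hb : b.fst ≫ b.inl + b.snd ≫ b.inr = 𝟙 b.pt) (hW : tateSubspaceRealization b.pt ℓ)
    {d : Module.End ℚ_[ℓ] (A.rationalTateModule ℓ)}
    (hd : ∀ φ : A ⟶ A, d ∘ₗ rationalTateModuleMap ℓ φ = rationalTateModuleMap ℓ φ ∘ₗ d)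
    {x : Module.End ℚ_[ℓ] (A.rationalTateModule ℓ)}
    (hx : ∀ (σ : Field.absoluteGaloisGroup K) (v : A.rationalTateModule ℓ),
      x (A.rationalTateRep ℓ σ v) = A.rationalTateRep ℓ σ (x v)) :
    d ∘ₗ x = x ∘ₗ d := by
  -- the four structure maps of `V_ℓ(b.pt) = V_ℓ A ⊕ V_ℓ A` and their identities
  set Fst := rationalTateModuleMap ℓ b.fst with hFst
  set Snd := rationalTateModuleMap ℓ b.snd with hSnd
  set Inl := rationalTateModuleMap ℓ b.inl with hInl
  set Inr := rationalTateModuleMap ℓ b.inr with hInr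
  have inl_fst : Fst ∘ₗ Inl = LinearMap.id := by
    rw [hFst, hInl, ← rationalTateModuleMap_comp, b.inl_fst, rationalTateModuleMap_id]
  have inr_fst : Fst ∘ₗ Inr = 0 := by
    rw [hFst, hInr, ← rationalTateModuleMap_comp, b.inr_fst, rationalTateModuleMap_zero]
  have inl_snd : Snd ∘ₗ Inl = 0 := by
    rw [hSnd, hInl, ← rationalTateModuleMap_comp, b.inl_snd, rationalTateModuleMap_zero]
  have inr_snd : Snd ∘ₗ Inr = LinearMap.id := by
    rw [hSnd, hInr, ← rationalTateModuleMap_comp, b.inr_snd, rationalTateModuleMap_id]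
  have total : Inl ∘ₗ Fst + Inr ∘ₗ Snd = LinearMap.id := by
    rw [hFst, hSnd, hInl, hInr, ← rationalTateModuleMap_comp, ← rationalTateModuleMap_comp,
      ← rationalTateModuleMap_add, hb, rationalTateModuleMap_id]
  have e1 : ∀ y, Fst (Inl y) = y := fun y ↦ by
    simpa only [LinearMap.comp_apply, LinearMap.id_apply] using LinearMap.congr_fun inl_fst y
  have e2 : ∀ y, Fst (Inr y) = 0 := fun y ↦ by
    simpa only [LinearMap.comp_apply, LinearMap.zero_apply] using LinearMap.congr_fun inr_fst y
  have e3 : ∀ y, Snd (Inl y) = 0 := fun y ↦ by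
    simpa only [LinearMap.comp_apply, LinearMap.zero_apply] using LinearMap.congr_fun inl_snd y
  have e4 : ∀ y, Snd (Inr y) = y := fun y ↦ by
    simpa only [LinearMap.comp_apply, LinearMap.id_apply] using LinearMap.congr_fun inr_snd y
  have etot : ∀ w, w = Inl (Fst w) + Inr (Snd w) := fun w ↦ by
    simpa only [LinearMap.add_apply, LinearMap.comp_apply, LinearMap.id_apply] using
      (LinearMap.congr_fun total w).symm
  -- the diagonal endomorphism `d_P = inl d fst + inr d snd` of `V_ℓ(b.pt)`
  set dP : Module.End ℚ_[ℓ] (b.pt.rationalTateModule ℓ) := Inl ∘ₗ d ∘ₗ Fst + Inr ∘ₗ d ∘ₗ Snd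
    with hdP
  have dP_inl : ∀ v, dP (Inl v) = Inl (d v) := fun v ↦ by
    simp only [hdP, LinearMap.add_apply, LinearMap.comp_apply, e1, e3, map_zero, add_zero]
  have dP_inr : ∀ v, dP (Inr v) = Inr (d v) := fun v ↦ by
    simp only [hdP, LinearMap.add_apply, LinearMap.comp_apply, e2, e4, map_zero, zero_add]
  have fst_dP : ∀ w, Fst (dP w) = d (Fst w) := fun w ↦ by
    simp only [hdP, LinearMap.add_apply, LinearMap.comp_apply, map_add, e1, e2, add_zero]
  have snd_dP : ∀ w, Snd (dP w) = d (Snd w) := fun w ↦ by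
    simp only [hdP, LinearMap.add_apply, LinearMap.comp_apply, map_add, e3, e4, zero_add]
  -- `d` commutes with the four corners `V(in_j ≫ φ ≫ pr_i)` of any `V_ℓ φ`, `φ ∈ End_K(b.pt)`
  have hcorner : ∀ (φ : b.pt ⟶ b.pt) (i : A ⟶ b.pt) (p : b.pt ⟶ A) (v : A.rationalTateModule ℓ),
      d (rationalTateModuleMap ℓ p (rationalTateModuleMap ℓ φ (rationalTateModuleMap ℓ i v))) =
        rationalTateModuleMap ℓ p (rationalTateModuleMap ℓ φ (rationalTateModuleMap ℓ i (d v))) :=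
    fun φ i p v ↦ by
      have h := LinearMap.congr_fun (hd (i ≫ φ ≫ p)) v
      simp only [LinearMap.comp_apply, rationalTateModuleMap_comp] at h
      exact h
  -- hence `d_P` commutes with every `V_ℓ φ`, `φ ∈ End_K(b.pt)` …
  have hgen : ∀ φ : b.pt ⟶ b.pt, ∀ w,
      dP (rationalTateModuleMap ℓ φ w) = rationalTateModuleMap ℓ φ (dP w) := by
    intro φ w
    -- compare the `Fst`- and `Snd`-components of both sides, writing `w = Inl a + Inr c`
    have key : ∀ w', (Fst (dP (rationalTateModuleMap ℓ φ w')) =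
          Fst (rationalTateModuleMap ℓ φ (dP w'))) ∧
        (Snd (dP (rationalTateModuleMap ℓ φ w')) = Snd (rationalTateModuleMap ℓ φ (dP w'))) := by
      intro w'
      rw [etot w']
      refine ⟨?_, ?_⟩
      · rw [fst_dP, map_add, map_add, map_add, map_add, map_add, dP_inl, dP_inr, map_add]
        rw [hFst, hInl, hInr, hcorner φ b.inl b.fst, hcorner φ b.inr b.fst]
      · rw [snd_dP, map_add, map_add, map_add, map_add, map_add, dP_inl, dP_inr, map_add]
        rw [hSnd, hInl, hInr, hcorner φ b.inl b.snd, hcorner φ b.inr b.snd]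
    obtain ⟨k1, k2⟩ := key w
    rw [etot (dP (rationalTateModuleMap ℓ φ w)), etot (rationalTateModuleMap ℓ φ (dP w)), k1, k2]
  -- … and with every element of `E_ℓ(b.pt)`
  have hspan : ∀ u ∈ rationalEndSpanAV b.pt ℓ, ∀ w, dP (u w) = u (dP w) := by
    intro u hu
    induction hu using Submodule.span_induction with
    | mem u hu' =>
      obtain ⟨φ, rfl⟩ := hu'
      exact hgen φ
    | zero => intro w; simp only [LinearMap.zero_apply, map_zero]
    | add u u' _ _ hu hu' => intro w; simp only [LinearMap.add_apply, map_add, hu, hu']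
    | smul c u _ hu => intro w; simp only [LinearMap.smul_apply, map_smul, hu]
  -- the graph of `x`, a `Γ_K`-stable subspace of `V_ℓ(b.pt)`
  set W : Submodule ℚ_[ℓ] (b.pt.rationalTateModule ℓ) := LinearMap.range (Inl + Inr ∘ₗ x)
    with hWdef
  have hstab : ∀ (σ : Field.absoluteGaloisGroup K) (v : b.pt.rationalTateModule ℓ),
      v ∈ W → b.pt.rationalTateRep ℓ σ v ∈ W := by
    rintro σ _ ⟨v, rfl⟩
    refine ⟨A.rationalTateRep ℓ σ v, ?_⟩
    simp only [LinearMap.add_apply, LinearMap.comp_apply, map_add]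
    rw [hInl, hInr, rationalTateRep_rationalTateModuleMap, hx,
      rationalTateRep_rationalTateModuleMap]
  obtain ⟨u, hu, hru⟩ := hW W hstab
  -- `d_P` stabilises `W = range u`
  have hdPW : ∀ w ∈ W, dP w ∈ W := by
    intro w hw
    rw [← hru] at hw ⊢
    obtain ⟨w₀, rfl⟩ := hw
    exact ⟨dP w₀, (hspan u hu w₀).symm⟩
  -- read off `x (d v) = d (x v)` from `d_P (inl v + inr (x v)) ∈ W`
  refine LinearMap.ext fun v ↦ ?_
  have hv : Inl v + Inr (x v) ∈ W := ⟨v, by simp only [LinearMap.add_apply, LinearMap.comp_apply]⟩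
  obtain ⟨v', hv'⟩ := hdPW _ hv
  have hv'' : Inl v' + Inr (x v') = Inl (d v) + Inr (d (x v)) := by
    simpa only [LinearMap.add_apply, LinearMap.comp_apply, map_add, dP_inl, dP_inr] using hv'
  have h1 : v' = d v := by
    have := congrArg Fst hv''
    rwa [map_add, map_add, e1, e2, e1, e2, add_zero, add_zero] at this
  have h2 : x v' = d (x v) := by
    have := congrArg Snd hv''
    rwa [map_add, map_add, e3, e4, e3, e4, zero_add, zero_add] at this
  rw [LinearMap.comp_apply, LinearMap.comp_apply, ← h2, h1]

end GraphCommutation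


/-! ## Jacobson density: the double centraliser of a semisimple `E_ℓ(A)` is `E_ℓ(A)` -/

section Density

variable {A : AbelianVariety K} (ℓ : ℕ) [Fact ℓ.Prime]

/-- **The double-centraliser step** (Kieffer 2024, Prop. 1.2.26, p. 32: "since `End(A) ⊗ ℚ_ℓ` is
a semisimple `ℚ_ℓ`-algebra, we conclude by the double centralizer theorem"; Tate 1966, §2). Let
`E_ℓ(A) ⊆ End_{ℚ_ℓ}(V_ℓ A)` be the subalgebra generated by the `V_ℓ φ`, `φ ∈ End_K(A)`, assumed
semisimple (`hss`), and let `T_ℓ A` be finitely generated (`hfinT`, so that `V_ℓ A` is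
finite-dimensional). If `x ∈ End_{ℚ_ℓ}(V_ℓ A)` commutes with every `d` in the centraliser of
`E_ℓ(A)`, then `x ∈ E_ℓ(A)`. Proof: `V_ℓ A` is a semisimple `E_ℓ(A)`-module, every
`E_ℓ(A)`-linear endomorphism of it is a `ℚ_ℓ`-linear map commuting with the `V_ℓ φ`, so `x` is
`End_{E_ℓ(A)}(V_ℓ A)`-linear, and Mathlib's Jacobson density theorem `jacobson_density` produces
`r ∈ E_ℓ(A)` agreeing with `x` on a finite `ℚ_ℓ`-spanning set, whence `x = r`. [folklore] -/
theorem mem_rationalEndSpanAV_of_forall_comp_eq (hfinT : module_finite_tateModule A ℓ)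
    (hss : IsSemisimpleRing ↥(Algebra.adjoin ℚ_[ℓ] (Set.range fun φ : A ⟶ A ↦
      (rationalTateModuleMap ℓ φ : Module.End ℚ_[ℓ] (A.rationalTateModule ℓ)))))
    {x : Module.End ℚ_[ℓ] (A.rationalTateModule ℓ)}
    (hx : ∀ d : Module.End ℚ_[ℓ] (A.rationalTateModule ℓ),
      (∀ φ : A ⟶ A, d ∘ₗ rationalTateModuleMap ℓ φ = rationalTateModuleMap ℓ φ ∘ₗ d) →
      d ∘ₗ x = x ∘ₗ d) :
    x ∈ rationalEndSpanAV A ℓ := by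
  classical
  haveI : Module.Finite ℤ_[ℓ] (A.tateModule ℓ) := hfinT
  haveI : Module.Finite ℚ_[ℓ] (A.rationalTateModule ℓ) := by
    change Module.Finite ℚ_[ℓ] (ℚ_[ℓ] ⊗[ℤ_[ℓ]] A.tateModule ℓ)
    infer_instance
  set E : Subalgebra ℚ_[ℓ] (Module.End ℚ_[ℓ] (A.rationalTateModule ℓ)) :=
    Algebra.adjoin ℚ_[ℓ] (Set.range fun φ : A ⟶ A ↦
      (rationalTateModuleMap ℓ φ : Module.End ℚ_[ℓ] (A.rationalTateModule ℓ))) with hE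
  haveI : IsSemisimpleRing E := hss
  -- every `E`-linear endomorphism `g` of `V_ℓ A` commutes with `x`
  have hxE : ∀ (g : Module.End E (A.rationalTateModule ℓ)) (v : A.rationalTateModule ℓ),
      x (g v) = g (x v) := by
    intro g v
    -- `g` as a `ℚ_ℓ`-linear map (`ℚ_ℓ ⊆ E` acts through `E`)
    let d : Module.End ℚ_[ℓ] (A.rationalTateModule ℓ) :=
      { toFun := g
        map_add' := g.map_add
        map_smul' := fun c w ↦ g.map_smul_of_tower c w }
    have hd : ∀ φ : A ⟶ A, d ∘ₗ rationalTateModuleMap ℓ φ = rationalTateModuleMap ℓ φ ∘ₗ d := by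
      intro φ
      refine LinearMap.ext fun w ↦ ?_
      have hmem : (rationalTateModuleMap ℓ φ : Module.End ℚ_[ℓ] (A.rationalTateModule ℓ)) ∈ E :=
        Algebra.subset_adjoin ⟨φ, rfl⟩
      have h := g.map_smul (⟨rationalTateModuleMap ℓ φ, hmem⟩ : E) w
      exact h
    have h := LinearMap.congr_fun (hx d hd) v
    exact h.symm
  -- `x` as an `End_E(V_ℓ A)`-linear endomorphism, and Jacobson density
  let f : Module.End (Module.End E (A.rationalTateModule ℓ)) (A.rationalTateModule ℓ) :=
    { toFun := x
      map_add' := x.map_add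
      map_smul' := fun g v ↦ hxE g v }
  obtain ⟨s, hs⟩ := Module.Finite.fg_top (R := ℚ_[ℓ]) (M := A.rationalTateModule ℓ)
  obtain ⟨r, hr⟩ := jacobson_density f s
  have hxr : x = (r : Module.End ℚ_[ℓ] (A.rationalTateModule ℓ)) :=
    LinearMap.ext_on hs fun m hm ↦ hr m hm
  rw [hxr, ← mem_adjoin_iff_mem_rationalEndSpanAV]
  exact r.2

/-- **`E_ℓ(A) = End_Γ(V_ℓ A)` from the lattice lemma and semisimplicity** (the `ℚ_ℓ`-form of
Tate's Main Theorem in `End` form, i.e. bijectivity of Tate's map (3)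
`ℚ_ℓ ⊗ End_K(A) → End_Γ(V_ℓ A)` onto the image side; Kieffer 2024, Prop. 1.2.26 with
Lemmas 1.2.23–1.2.25; Tate 1966, §2). Let `b` be a bicone of `(A, A)` with the total identity (a
biproduct `A ⊞ A`), assume Tate's lattice lemma for `b.pt` at `ℓ` (`hW`), `T_ℓ A` finitely
generated (`hfinT`) and `E_ℓ(A)` semisimple (`hss`, Poincaré reducibility ⊗ `ℚ_ℓ`). Then a
`ℚ_ℓ`-linear endomorphism `x` of `V_ℓ A` lies in `E_ℓ(A)`, the `ℚ_ℓ`-span of the `V_ℓ φ`,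
`φ ∈ End_K(A)`, iff it is `Γ_K`-equivariant: "only if" is the equivariance of each `V_ℓ φ`; "if"
is graph commutation (`comp_eq_comp_of_tateSubspaceRealization`) followed by Jacobson density
(`mem_rationalEndSpanAV_of_forall_comp_eq`). Valid over any field `K` for which the hypotheses
hold. [folklore] -/
theorem mem_rationalEndSpanAV_iff_of_tateSubspaceRealization (b : BinaryBicone A A)
    (hb : b.fst ≫ b.inl + b.snd ≫ b.inr = 𝟙 b.pt) (hW : tateSubspaceRealization b.pt ℓ)
    (hfinT : module_finite_tateModule A ℓ)
    (hss : IsSemisimpleRing ↥(Algebra.adjoin ℚ_[ℓ] (Set.range fun φ : A ⟶ A ↦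
      (rationalTateModuleMap ℓ φ : Module.End ℚ_[ℓ] (A.rationalTateModule ℓ)))))
    (x : Module.End ℚ_[ℓ] (A.rationalTateModule ℓ)) :
    x ∈ rationalEndSpanAV A ℓ ↔
      ∀ (σ : Field.absoluteGaloisGroup K) (v : A.rationalTateModule ℓ),
        x (A.rationalTateRep ℓ σ v) = A.rationalTateRep ℓ σ (x v) :=
  ⟨fun hx σ v ↦ apply_rationalTateRep_of_mem_rationalEndSpanAV ℓ hx σ v,
    fun hx ↦ mem_rationalEndSpanAV_of_forall_comp_eq ℓ hfinT hss
      (fun _ hd ↦ comp_eq_comp_of_tateSubspaceRealization ℓ b hb hW hd hx)⟩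

end Density

/-! ## Over a finite field -/

section FiniteField

variable {A : AbelianVariety K} (ℓ : ℕ) [Fact ℓ.Prime]

/-- **Tate's Main Theorem ⊗ `ℚ_ℓ`, `End` form, over a finite field, from the named facts.** Let
`K` be finite, `(ℓ : K) ≠ 0`, `b` a bicone of `(A, A)` with the total identity, and grant: the
finiteness of the set of `K`-isomorphism classes of abelian varieties of dimension `dim b.pt`
over `K` (`hfin`, Milne 1986 Cor. 18.9), quotients of `b.pt` by finite `Γ_K`-stable subgroups
(`hq`, Kieffer Prop. 1.1.10–1.1.13), `T_ℓ(b.pt)` free and finitely generated and `T_ℓ A`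
finitely generated (`hfreeP`, `hfinTP`, `hfinT`, Mumford §19), and `E_ℓ(A)` semisimple (`hss`,
Mumford §19 Cor. 2 of Thm. 1 ⊗ `ℚ_ℓ`). Then `x ∈ End_{ℚ_ℓ}(V_ℓ A)` lies in the `ℚ_ℓ`-span of the
`V_ℓ φ`, `φ ∈ End_K(A)`, iff it commutes with `Γ_K` (Tate 1966, Main Theorem ⊗ `ℚ_ℓ`; Kieffer
2024, Thm. 1.2.11 via Prop. 1.2.26): the lattice lemma is the tree's
`tateSubspaceRealization_of_finite_of_quotient`, the rest is
`mem_rationalEndSpanAV_iff_of_tateSubspaceRealization`. [folklore] -/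
theorem mem_rationalEndSpanAV_iff_of_finite [Finite K] (hℓ : (ℓ : K) ≠ 0) (b : BinaryBicone A A)
    (hb : b.fst ≫ b.inl + b.snd ≫ b.inr = 𝟙 b.pt)
    (hfin : finite_isoClasses_of_finite K b.pt.dim) (hq : exists_quotient_isogeny b.pt ℓ)
    (hfreeP : module_free_tateModule b.pt ℓ) (hfinTP : module_finite_tateModule b.pt ℓ)
    (hfinT : module_finite_tateModule A ℓ)
    (hss : IsSemisimpleRing ↥(Algebra.adjoin ℚ_[ℓ] (Set.range fun φ : A ⟶ A ↦
      (rationalTateModuleMap ℓ φ : Module.End ℚ_[ℓ] (A.rationalTateModule ℓ)))))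
    (x : Module.End ℚ_[ℓ] (A.rationalTateModule ℓ)) :
    x ∈ rationalEndSpanAV A ℓ ↔
      ∀ (σ : Field.absoluteGaloisGroup K) (v : A.rationalTateModule ℓ),
        x (A.rationalTateRep ℓ σ v) = A.rationalTateRep ℓ σ (x v) :=
  mem_rationalEndSpanAV_iff_of_tateSubspaceRealization ℓ b hb
    (tateSubspaceRealization_of_finite_of_quotient b.pt ℓ hℓ hfin hq
      (fun _ ↦ dim_eq_of_isIsogenous_holds) hfreeP hfinTP) hfinT hss x

variable (A) in
/-- The same for the biproduct `A ⊞ A` chosen by the instance `HasBinaryBiproducts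
(AbelianVariety K)` of `AbelianVarietyProduct` (Mathlib `BinaryBiproduct.bicone`, `biprod.total`):
over a finite field `K` with `(ℓ : K) ≠ 0`, granted the named facts for `A ⊞ A` and `A` and the
semisimplicity of `E_ℓ(A)`, an endomorphism of `V_ℓ A` is in the `ℚ_ℓ`-span of `End_K(A)` iff it
is `Γ_K`-equivariant (Tate 1966, Main Theorem ⊗ `ℚ_ℓ`, `End` form). [folklore] -/
theorem mem_rationalEndSpanAV_iff_of_finite_biprod [Finite K] (hℓ : (ℓ : K) ≠ 0)
    (hfin : finite_isoClasses_of_finite K (A ⊞ A).dim) (hq : exists_quotient_isogeny (A ⊞ A) ℓ)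
    (hfreeP : module_free_tateModule (A ⊞ A) ℓ) (hfinTP : module_finite_tateModule (A ⊞ A) ℓ)
    (hfinT : module_finite_tateModule A ℓ)
    (hss : IsSemisimpleRing ↥(Algebra.adjoin ℚ_[ℓ] (Set.range fun φ : A ⟶ A ↦
      (rationalTateModuleMap ℓ φ : Module.End ℚ_[ℓ] (A.rationalTateModule ℓ)))))
    (x : Module.End ℚ_[ℓ] (A.rationalTateModule ℓ)) :
    x ∈ rationalEndSpanAV A ℓ ↔
      ∀ (σ : Field.absoluteGaloisGroup K) (v : A.rationalTateModule ℓ),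
        x (A.rationalTateRep ℓ σ v) = A.rationalTateRep ℓ σ (x v) :=
  mem_rationalEndSpanAV_iff_of_finite ℓ hℓ (BinaryBiproduct.bicone A A) biprod.total hfin hq hfreeP
    hfinTP hfinT hss x

end FiniteField


/-! ## `Hom` from `End`: the Main Theorem for `(A, B)` from its `End` form for `A ⊞ B` -/

section HomFromEnd

variable {A B : AbelianVariety K} (ℓ : ℕ) [Fact ℓ.Prime]

/-- **Span criterion for surjectivity of the Tate map.** If every `Γ_K`-equivariant `ℤ_ℓ`-linear
`g : T_ℓ A → T_ℓ B` lies in the `ℤ_ℓ`-span of the `T_ℓ f`, `f ∈ Hom_K(A, B)`, then the Tate map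
`ℤ_ℓ ⊗ Hom_K(A, B) → Hom_Γ(T_ℓ A, T_ℓ B)` is surjective (its range is a submodule containing every
`T_ℓ f = (1 ⊗ f)`, and `g ↦ g.toLinearMap` is injective and `ℤ_ℓ`-linear); converse of
`toLinearMap_mem_span_of_mem_range`. [folklore] -/
theorem surjective_faltingsTateMap_of_forall_mem_span
    (h : ∀ g : tateHom A B ℓ,
      g.toLinearMap ∈ Submodule.span ℤ_[ℓ] (Set.range (tateModuleMap ℓ : (A ⟶ B) → _))) :
    Function.Surjective (faltingsTateMap A B ℓ) := by
  -- `toLinearMap` as a `ℤ_ℓ`-linear map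
  let L : tateHom A B ℓ →ₗ[ℤ_[ℓ]] (A.tateModule ℓ →ₗ[ℤ_[ℓ]] B.tateModule ℓ) :=
    { toFun := fun g ↦ g.toLinearMap
      map_add' := fun g g' ↦ Representation.IntertwiningMap.add_toLinearMap _ _ g g'
      map_smul' := fun c g ↦ Representation.IntertwiningMap.toLinearMap_smul _ _ c g }
  have hle : Submodule.span ℤ_[ℓ] (Set.range (tateModuleMap ℓ : (A ⟶ B) → _)) ≤
      (LinearMap.range (faltingsTateMap A B ℓ)).map L := by
    refine Submodule.span_le.mpr ?_
    rintro _ ⟨f, rfl⟩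
    exact ⟨tateIntertwiningMap ℓ f, tateIntertwiningMap_mem_range ℓ f, rfl⟩
  intro g
  obtain ⟨g', ⟨t, rfl⟩, hLg⟩ := hle (h g)
  exact ⟨t, Representation.IntertwiningMap.ext hLg⟩

/-- **Transport of the Tate map along corners.** For homomorphisms `i : A' → A`, `p : B → B'` and
the additive map `c : Hom_K(A, B) → Hom_K(A', B')`, `f ↦ i ≫ f ≫ p`, the Tate map of
`(1 ⊗ c) t` is `T_ℓ p ∘ (Tate map of t) ∘ T_ℓ i` (functoriality of `T_ℓ`, `tateModuleMap_comp`, on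
pure tensors, and additivity). [folklore] -/
theorem toLinearMap_faltingsTateMap_lTensor {A A' B B' : AbelianVariety K} (i : A' ⟶ A)
    (p : B ⟶ B') (c : (A ⟶ B) →ₗ[ℤ] (A' ⟶ B')) (hc : ∀ f, c f = i ≫ f ≫ p)
    (t : ℤ_[ℓ] ⊗[ℤ] (A ⟶ B)) :
    (faltingsTateMap A' B' ℓ (LinearMap.lTensor ℤ_[ℓ] c t)).toLinearMap =
      (tateModuleMap ℓ p).comp ((faltingsTateMap A B ℓ t).toLinearMap.comp (tateModuleMap ℓ i)) := by
  induction t using TensorProduct.induction_on with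
  | zero =>
    simp only [map_zero, Representation.IntertwiningMap.zero_toLinearMap, LinearMap.zero_comp,
      LinearMap.comp_zero]
  | tmul a f =>
    rw [LinearMap.lTensor_tmul, faltingsTateMap_tmul, faltingsTateMap_tmul,
      Representation.IntertwiningMap.toLinearMap_smul,
      Representation.IntertwiningMap.toLinearMap_smul, homToTate_apply, homToTate_apply,
      toLinearMap_tateIntertwiningMap, toLinearMap_tateIntertwiningMap, hc, tateModuleMap_comp,
      tateModuleMap_comp, LinearMap.smul_comp, LinearMap.comp_smul, LinearMap.comp_assoc]
  | add s t hs ht =>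
    simp only [map_add, Representation.IntertwiningMap.add_toLinearMap, hs, ht,
      LinearMap.add_comp, LinearMap.comp_add]

/-- **Injectivity for `Hom_K(A, B)` from injectivity for `End_K(A ⊞ B)`.** For a bicone `b` of
`(A, B)`: if the Tate map of `End_K(b.pt)` is injective, so is that of `Hom_K(A, B)` — transport
`t ↦ (1 ⊗ (f ↦ b.fst ≫ f ≫ b.inr)) t`, whose Tate map is `T(inr) ∘ (Tate map of t) ∘ T(fst)`, and
come back with `φ ↦ b.inl ≫ φ ≫ b.snd` (`inl ≫ fst = 𝟙`, `inr ≫ snd = 𝟙`). Kieffer 2024, proof of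
Prop. 1.2.7, p. 22 (`End(A × B) = End(A) ⊕ Hom(A, B) ⊕ Hom(B, A) ⊕ End(B)`). [folklore] -/
theorem injective_faltingsTateMap_of_end (b : BinaryBicone A B)
    (h : Function.Injective (faltingsTateMap b.pt b.pt ℓ)) :
    Function.Injective (faltingsTateMap A B ℓ) := by
  let c₁ : (A ⟶ B) →ₗ[ℤ] (b.pt ⟶ b.pt) :=
    (AddMonoidHom.mk' (fun f ↦ b.fst ≫ f ≫ b.inr)
      (fun f g ↦ by rw [Preadditive.add_comp, Preadditive.comp_add])).toIntLinearMap
  let c₂ : (b.pt ⟶ b.pt) →ₗ[ℤ] (A ⟶ B) :=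
    (AddMonoidHom.mk' (fun φ ↦ b.inl ≫ φ ≫ b.snd)
      (fun f g ↦ by rw [Preadditive.add_comp, Preadditive.comp_add])).toIntLinearMap
  have hc₁ : ∀ f, c₁ f = b.fst ≫ f ≫ b.inr := fun f ↦ rfl
  have hc₂₁ : ∀ f, c₂ (c₁ f) = f := fun f ↦ by
    change b.inl ≫ (b.fst ≫ f ≫ b.inr) ≫ b.snd = f
    simp only [Category.assoc, b.inr_snd, Category.comp_id]
    rw [← Category.assoc, b.inl_fst, Category.id_comp]
  have hll : ∀ t : ℤ_[ℓ] ⊗[ℤ] (A ⟶ B),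
      LinearMap.lTensor ℤ_[ℓ] c₂ (LinearMap.lTensor ℤ_[ℓ] c₁ t) = t := fun t ↦ by
    have hcomp : c₂ ∘ₗ c₁ = LinearMap.id := LinearMap.ext hc₂₁
    rw [← LinearMap.comp_apply, ← LinearMap.lTensor_comp, hcomp, LinearMap.lTensor_id,
      LinearMap.id_apply]
  rw [injective_iff_map_eq_zero]
  intro t ht
  have h1 : faltingsTateMap b.pt b.pt ℓ (LinearMap.lTensor ℤ_[ℓ] c₁ t) = 0 := by
    apply Representation.IntertwiningMap.ext
    rw [toLinearMap_faltingsTateMap_lTensor ℓ b.fst b.inr c₁ hc₁ t, ht,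
      Representation.IntertwiningMap.zero_toLinearMap, LinearMap.zero_comp, LinearMap.comp_zero,
      Representation.IntertwiningMap.zero_toLinearMap]
  have h2 : LinearMap.lTensor ℤ_[ℓ] c₁ t = 0 := h (h1.trans (map_zero _).symm)
  rw [← hll t, h2, map_zero]

/-- **Surjectivity for `Hom_K(A, B)` from surjectivity for `End_K(A ⊞ B)`.** For a bicone `b` of
`(A, B)`: if the Tate map of `End_K(b.pt)` is surjective, so is that of `Hom_K(A, B)` — a
`Γ_K`-equivariant `g : T_ℓ A → T_ℓ B` gives the equivariant `G = T(inr) ∘ g ∘ T(fst)` on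
`T_ℓ(b.pt)`, which lies in the `ℤ_ℓ`-span of the `T_ℓ φ`, `φ ∈ End_K(b.pt)`; applying
`E ↦ T(snd) ∘ E ∘ T(inl)` (which sends `T_ℓ φ` to `T_ℓ(inl ≫ φ ≫ snd)`) returns `g` in the span of
the `T_ℓ f`, `f ∈ Hom_K(A, B)`. Kieffer 2024, Prop. 1.2.20 (p. 28); Milne, *The Work of John
Tate*, §4.3.1 ("It suffices to prove the statement with `A = B`"). [folklore] -/
theorem surjective_faltingsTateMap_of_end (b : BinaryBicone A B)
    (h : Function.Surjective (faltingsTateMap b.pt b.pt ℓ)) :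
    Function.Surjective (faltingsTateMap A B ℓ) := by
  refine surjective_faltingsTateMap_of_forall_mem_span ℓ fun g ↦ ?_
  -- the structure maps of `T_ℓ(b.pt)` that are needed
  have e1 : ∀ v, tateModuleMap ℓ b.fst (tateModuleMap ℓ b.inl v) = v := fun v ↦ by
    rw [← LinearMap.comp_apply, ← tateModuleMap_comp, b.inl_fst, tateModuleMap_id,
      LinearMap.id_apply]
  have e4 : ∀ w, tateModuleMap ℓ b.snd (tateModuleMap ℓ b.inr w) = w := fun w ↦ by
    rw [← LinearMap.comp_apply, ← tateModuleMap_comp, b.inr_snd, tateModuleMap_id,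
      LinearMap.id_apply]
  -- `G = T(inr) ∘ g ∘ T(fst)`, an equivariant endomorphism of `T_ℓ(b.pt)`
  let G : tateHom b.pt b.pt ℓ :=
    (tateModuleMap ℓ b.inr ∘ₗ g.toLinearMap ∘ₗ tateModuleMap ℓ b.fst).intertwiningMap_of_isIntertwiningMap
      (b.pt.tateRep ℓ) (b.pt.tateRep ℓ) (fun σ v ↦ by
        simp only [LinearMap.comp_apply, Representation.IntertwiningMap.coe_toLinearMap]
        rw [tateModuleMap_smul, g.isIntertwining, tateModuleMap_smul])
  obtain ⟨tP, htP⟩ := h G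
  have hG : G.toLinearMap ∈
      Submodule.span ℤ_[ℓ] (Set.range (tateModuleMap ℓ : (b.pt ⟶ b.pt) → _)) :=
    toLinearMap_mem_span_of_mem_range ℓ ⟨tP, htP⟩
  -- `E ↦ T(snd) ∘ E ∘ T(inl)`, a `ℤ_ℓ`-linear map sending `T_ℓ φ` to `T_ℓ (inl ≫ φ ≫ snd)`
  let Φ : (b.pt.tateModule ℓ →ₗ[ℤ_[ℓ]] b.pt.tateModule ℓ) →ₗ[ℤ_[ℓ]]
      (A.tateModule ℓ →ₗ[ℤ_[ℓ]] B.tateModule ℓ) :=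
    { toFun := fun E ↦ tateModuleMap ℓ b.snd ∘ₗ E ∘ₗ tateModuleMap ℓ b.inl
      map_add' := fun E E' ↦ by rw [LinearMap.add_comp, LinearMap.comp_add]
      map_smul' := fun c E ↦ by rw [LinearMap.smul_comp, LinearMap.comp_smul, RingHom.id_apply] }
  have hΦ : ∀ φ : b.pt ⟶ b.pt, Φ (tateModuleMap ℓ φ) = tateModuleMap ℓ (b.inl ≫ φ ≫ b.snd) :=
    fun φ ↦ by
      change tateModuleMap ℓ b.snd ∘ₗ tateModuleMap ℓ φ ∘ₗ tateModuleMap ℓ b.inl = _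
      rw [tateModuleMap_comp, tateModuleMap_comp, LinearMap.comp_assoc]
  have hle : (Submodule.span ℤ_[ℓ] (Set.range (tateModuleMap ℓ : (b.pt ⟶ b.pt) → _))).map Φ ≤
      Submodule.span ℤ_[ℓ] (Set.range (tateModuleMap ℓ : (A ⟶ B) → _)) := by
    rw [Submodule.map_span]
    refine Submodule.span_mono ?_
    rintro _ ⟨_, ⟨φ, rfl⟩, rfl⟩
    exact ⟨b.inl ≫ φ ≫ b.snd, (hΦ φ).symm⟩
  have hΦG : Φ G.toLinearMap = g.toLinearMap := by
    refine LinearMap.ext fun v ↦ ?_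
    change tateModuleMap ℓ b.snd (tateModuleMap ℓ b.inr
      (g (tateModuleMap ℓ b.fst (tateModuleMap ℓ b.inl v)))) = g v
    rw [e1, e4]
  rw [← hΦG]
  exact hle ⟨G.toLinearMap, hG, rfl⟩

/-- **`Hom` from `End`** (Kieffer 2024, Prop. 1.2.20, p. 28: "Assume that Theorem 1.2.11 holds
when `A = B` is any abelian variety over `k`. Then it holds for all pairs of abelian varieties
`(A, B)`. Proof. Apply Tate's theorem to `End(A × B)`"; Milne, *The Work of John Tate*, §4.3.1;
Faltings 1983 §5, Korollar 1 from Satz 4). For a bicone `b` of `(A, B)` — e.g. the biproduct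
`A ⊞ B` — the `End` form `tate_end_bijective_of_finite b.pt ℓ` of Tate's Main Theorem implies the
`Hom` form `tate_bijective_of_finite A B ℓ`; converse direction of
`tate_end_bijective_of_finite_of`. [cite: Kieffer2024IsogenyGraphs, Prop. 1.2.20] -/
theorem tate_bijective_of_finite_of_end (b : BinaryBicone A B)
    (h : tate_end_bijective_of_finite b.pt ℓ) : tate_bijective_of_finite A B ℓ :=
  fun {_} hℓ ↦
    ⟨injective_faltingsTateMap_of_end ℓ b (h hℓ).1, surjective_faltingsTateMap_of_end ℓ b (h hℓ).2⟩

variable (A B) in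
/-- `Hom` from `End` for the biproduct `A ⊞ B` of the instance `HasBinaryBiproducts
(AbelianVariety K)` (`AbelianVarietyProduct`): `tate_end_bijective_of_finite (A ⊞ B) ℓ` implies
`tate_bijective_of_finite A B ℓ` (Kieffer 2024, Prop. 1.2.20). [folklore] -/
theorem tate_bijective_of_finite_of_end_biprod (h : tate_end_bijective_of_finite (A ⊞ B) ℓ) :
    tate_bijective_of_finite A B ℓ :=
  tate_bijective_of_finite_of_end ℓ (BinaryBiproduct.bicone A B) h

/-- **The Main Theorem is equivalent to its `End` form** (Tate 1966; Milne, *The Work of John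
Tate*, §4.3.1: "It suffices to prove the statement with `A = B`"; Kieffer 2024, Prop. 1.2.20):
over a field `K` and for a prime `ℓ`, Tate's theorem `tate_bijective_of_finite A B ℓ` holds for
all pairs `(A, B)` of abelian varieties over `K` iff its `End` form
`tate_end_bijective_of_finite P ℓ` holds for all `P` (`⇐` through `P = A ⊞ B`, `⇒` with
`A = B = P`). [folklore] -/
theorem forall_tate_bijective_of_finite_iff_forall_end :
    (∀ A B : AbelianVariety K, tate_bijective_of_finite A B ℓ) ↔
      ∀ P : AbelianVariety K, tate_end_bijective_of_finite P ℓ :=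
  ⟨fun h P ↦ tate_end_bijective_of_finite_of P ℓ (h P P),
    fun h A B ↦ tate_bijective_of_finite_of_end_biprod A B ℓ (h (A ⊞ B))⟩

end HomFromEnd


/-! ## The integral consequence: a non-zero multiple of every equivariant endomorphism of `T_ℓ A` lies in `ℤ_ℓ · End_K(A)` -/

section Integral

variable {A : AbelianVariety K} (ℓ : ℕ) [Fact ℓ.Prime]

open Literature.NumberTheory.EllipticCurves in
/-- **Clearing denominators** (Tate 1966, §1, the passage from the `ℚ_ℓ`-statement (3) to
multiples in the `ℤ_ℓ`-statement (1); Kieffer 2024, Prop. 1.2.21–1.2.22). If `ℚ_ℓ ⊗ g` lies in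
`E_ℓ(A)`, the `ℚ_ℓ`-span of the `V_ℓ φ`, `φ ∈ End_K(A)`, then some non-zero `ℤ_ℓ`-multiple
`N • g` lies in the `ℤ_ℓ`-span of the `T_ℓ φ`: write `ℚ_ℓ ⊗ g = Σ c_φ V_ℓ φ` (finite sum), take a
common denominator `N` of the `c_φ` (`IsLocalization.exist_integer_multiples` for
`ℚ_ℓ = Frac ℤ_ℓ`), and compare `N • g` with `Σ (N c_φ) T_ℓ φ` after `T_ℓ A ↪ V_ℓ A`
(`TateModule.toRational_injective`), where both become `Σ (N c_φ) (1 ⊗ T_ℓ φ (t))`. Converse of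
`baseChange_mem_rationalEndSpanAV` up to the multiple. [folklore] -/
theorem exists_ne_zero_smul_mem_span_of_baseChange_mem_rationalEndSpanAV
    {g : Module.End ℤ_[ℓ] (A.tateModule ℓ)}
    (hg : (g.baseChange ℚ_[ℓ] : Module.End ℚ_[ℓ] (A.rationalTateModule ℓ)) ∈
      rationalEndSpanAV A ℓ) :
    ∃ N : ℤ_[ℓ], N ≠ 0 ∧
      N • g ∈ Submodule.span ℤ_[ℓ] (Set.range (tateModuleMap ℓ : (A ⟶ A) → _)) := by
  classical
  set x : Module.End ℚ_[ℓ] (A.rationalTateModule ℓ) := g.baseChange ℚ_[ℓ] with hxdef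
  have hxt : ∀ t : A.tateModule ℓ,
      x (TateModule.toRational ℓ t) = TateModule.toRational ℓ (g t) := fun t ↦ rfl
  rw [rationalEndSpanAV_def] at hg
  obtain ⟨c, hc⟩ := (Finsupp.mem_span_range_iff_exists_finsupp
    (M := Module.End ℚ_[ℓ] (A.rationalTateModule ℓ))).mp hg
  obtain ⟨⟨d, hd0⟩, hint⟩ :=
    IsLocalization.exist_integer_multiples (nonZeroDivisors ℤ_[ℓ]) c.support c
  have hint' : ∀ a ∈ c.support, ∃ z : ℤ_[ℓ], algebraMap ℤ_[ℓ] ℚ_[ℓ] z = d • c a :=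
    fun a ha ↦ hint a ha
  choose! z hz using hint'
  refine ⟨d, nonZeroDivisors.ne_zero hd0, ?_⟩
  have key : d • g = ∑ a ∈ c.support, z a • tateModuleMap ℓ a := by
    refine LinearMap.ext fun t ↦ TateModule.toRational_injective ?_
    have hl : TateModule.toRational ℓ ((d • g) t) = d • x (TateModule.toRational ℓ t) := by
      rw [LinearMap.smul_apply, map_smul, hxt]
    have hxsum : x (TateModule.toRational ℓ t) =
        ∑ a ∈ c.support, c a • TateModule.toRational ℓ (tateModuleMap ℓ a t) := by
      rw [← hc, Finsupp.sum, LinearMap.sum_apply]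
      refine Finset.sum_congr rfl fun a _ ↦ ?_
      rw [LinearMap.smul_apply, rationalTateModuleMap_toRational]
    have hr : TateModule.toRational ℓ ((∑ a ∈ c.support, z a • tateModuleMap ℓ a) t) =
        ∑ a ∈ c.support, z a • TateModule.toRational ℓ (tateModuleMap ℓ a t) := by
      rw [LinearMap.sum_apply, map_sum]
      refine Finset.sum_congr rfl fun a _ ↦ ?_
      rw [LinearMap.smul_apply, map_smul]
    change TateModule.toRational ℓ ((d • g) t) =
      TateModule.toRational ℓ ((∑ a ∈ c.support, z a • tateModuleMap ℓ a) t)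
    rw [hl, hr, hxsum, Finset.smul_sum]
    refine Finset.sum_congr rfl fun a ha ↦ ?_
    rw [← smul_assoc, ← hz a ha, algebraMap_smul]
  rw [key]
  exact Submodule.sum_mem _ fun a _ ↦ Submodule.smul_mem _ _ (Submodule.subset_span ⟨a, rfl⟩)

/-- **Tate's Main Theorem ⊗ `ℚ_ℓ` in integral terms, `End` form** (Tate 1966, bijectivity of
(3): `ℚ_ℓ ⊗ End_k(A) → End_G(V_ℓ A)`; Kieffer 2024, Prop. 1.2.26 with Prop. 1.2.22). Under the
hypotheses of `mem_rationalEndSpanAV_iff_of_tateSubspaceRealization` (lattice lemma for a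
biproduct `A ⊞ A`, `T_ℓ A` finitely generated, `E_ℓ(A)` semisimple), every `Γ_K`-equivariant
`ℤ_ℓ`-linear endomorphism `g` of `T_ℓ A` has a non-zero multiple `N • g`, `N ∈ ℤ_ℓ ∖ {0}`, in the
`ℤ_ℓ`-span of the `T_ℓ φ`, `φ ∈ End_K(A)`. What separates this from `tate_end_bijective_of_finite`
is exactly Tate's Lemma 1 / Kieffer Prop. 1.2.21 (the span is `ℓ`-saturated in `End(T_ℓ A)`) and
the injectivity `AbelianVariety.faltingsTateMap_injective`. [folklore] -/
theorem exists_ne_zero_smul_mem_span_of_equivariant_of_tateSubspaceRealization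
    (b : BinaryBicone A A) (hb : b.fst ≫ b.inl + b.snd ≫ b.inr = 𝟙 b.pt)
    (hW : tateSubspaceRealization b.pt ℓ) (hfinT : module_finite_tateModule A ℓ)
    (hss : IsSemisimpleRing ↥(Algebra.adjoin ℚ_[ℓ] (Set.range fun φ : A ⟶ A ↦
      (rationalTateModuleMap ℓ φ : Module.End ℚ_[ℓ] (A.rationalTateModule ℓ)))))
    (g : Module.End ℤ_[ℓ] (A.tateModule ℓ))
    (hg : ∀ (σ : Field.absoluteGaloisGroup K) (x : A.tateModule ℓ), g (σ • x) = σ • g x) :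
    ∃ N : ℤ_[ℓ], N ≠ 0 ∧
      N • g ∈ Submodule.span ℤ_[ℓ] (Set.range (tateModuleMap ℓ : (A ⟶ A) → _)) :=
  exists_ne_zero_smul_mem_span_of_baseChange_mem_rationalEndSpanAV ℓ
    ((mem_rationalEndSpanAV_iff_of_tateSubspaceRealization ℓ b hb hW hfinT hss _).mpr
      (rationalTateRep_baseChange_of_equivariant ℓ g hg))

/-- **Over a finite field** (Tate 1966, Main Theorem ⊗ `ℚ_ℓ`, `End` form, in integral terms, from
the named facts): for `K` finite, `(ℓ : K) ≠ 0`, a bicone `b` of `(A, A)` with the total identity,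
and granted `finite_isoClasses_of_finite K b.pt.dim` (Milne 1986, Cor. 18.9),
`exists_quotient_isogeny b.pt ℓ` (Kieffer Prop. 1.1.10–1.1.13), `T_ℓ(b.pt)` free and finitely
generated, `T_ℓ A` finitely generated (Mumford §19) and `E_ℓ(A)` semisimple (Mumford §19 Cor. 2
of Thm. 1 ⊗ `ℚ_ℓ`): every `Γ_K`-equivariant `ℤ_ℓ`-linear endomorphism `g` of `T_ℓ A` has a
non-zero `ℤ_ℓ`-multiple in `ℤ_ℓ · End_K(A) ⊆ End(T_ℓ A)`. [folklore] -/
theorem exists_ne_zero_smul_mem_span_of_equivariant_of_finite [Finite K] (hℓ : (ℓ : K) ≠ 0)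
    (b : BinaryBicone A A) (hb : b.fst ≫ b.inl + b.snd ≫ b.inr = 𝟙 b.pt)
    (hfin : finite_isoClasses_of_finite K b.pt.dim) (hq : exists_quotient_isogeny b.pt ℓ)
    (hfreeP : module_free_tateModule b.pt ℓ) (hfinTP : module_finite_tateModule b.pt ℓ)
    (hfinT : module_finite_tateModule A ℓ)
    (hss : IsSemisimpleRing ↥(Algebra.adjoin ℚ_[ℓ] (Set.range fun φ : A ⟶ A ↦
      (rationalTateModuleMap ℓ φ : Module.End ℚ_[ℓ] (A.rationalTateModule ℓ)))))
    (g : Module.End ℤ_[ℓ] (A.tateModule ℓ))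
    (hg : ∀ (σ : Field.absoluteGaloisGroup K) (x : A.tateModule ℓ), g (σ • x) = σ • g x) :
    ∃ N : ℤ_[ℓ], N ≠ 0 ∧
      N • g ∈ Submodule.span ℤ_[ℓ] (Set.range (tateModuleMap ℓ : (A ⟶ A) → _)) :=
  exists_ne_zero_smul_mem_span_of_equivariant_of_tateSubspaceRealization ℓ b hb
    (tateSubspaceRealization_of_finite_of_quotient b.pt ℓ hℓ hfin hq
      (fun _ ↦ dim_eq_of_isIsogenous_holds) hfreeP hfinTP) hfinT hss g hg

end Integral


/-! ## Assembly: what the `End` form of the Main Theorem still needs -/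

section Assembly

variable (A : AbelianVariety K) (ℓ : ℕ) [Fact ℓ.Prime]

/-- **Tate's Main Theorem in `End` form, from the named facts, semisimplicity, injectivity and
saturation.** For an abelian variety `A` over a field `K` and a prime `ℓ`, grant:
* the finiteness of `K`-isomorphism classes in dimension `dim (A ⊞ A)` over `K` finite
  (`hfin`, `AbelianVariety.finite_isoClasses_of_finite`, Milne 1986 Cor. 18.9) and quotients of
  `A ⊞ A` by finite `Γ_K`-stable subgroups (`hq`, `AbelianVariety.exists_quotient_isogeny`,
  Kieffer 2024 Prop. 1.1.10–1.1.13) — the inputs of the lattice lemma;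
* `T_ℓ(A ⊞ A)` free and finitely generated, `T_ℓ A` finitely generated (`hfreeP`, `hfinTP`,
  `hfinT`; Mumford §19);
* `E_ℓ(A)` semisimple (`hss`; Mumford §19, Cor. 2 of Thm. 1, ⊗ `ℚ_ℓ`);
* injectivity of the Tate map of `End_K(A)` (`hinj`, `AbelianVariety.faltingsTateMap_injective`,
  Mumford §19 Thm. 3) and saturation of `ℤ_ℓ · End_K(A)` in `End(T_ℓ A)` (`hsat`: a `ℤ_ℓ`-linear
  endomorphism with a non-zero multiple in the `ℤ_ℓ`-span of the `T_ℓ φ` is in that span — the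
  torsion-freeness of the cokernel, Tate 1966 §1 Lemma 1; Milne 1986, Thm. 12.5; Kieffer 2024,
  Prop. 1.2.21).
Then `tate_end_bijective_of_finite A ℓ`: for `K` finite and `(ℓ : K) ≠ 0` the Tate map
`ℤ_ℓ ⊗ End_K(A) → End_Γ(T_ℓ A)` is bijective (Tate 1966, Main Theorem; Kieffer 2024,
Thm. 1.2.11). Injectivity is `hinj`; for surjectivity, an equivariant `g` has a non-zero multiple
in `ℤ_ℓ · End_K(A)` (`exists_ne_zero_smul_mem_span_of_equivariant_of_finite`), hence lies there
(`hsat`), and the span criterion `surjective_faltingsTateMap_of_forall_mem_span` concludes. This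
theorem records exactly which classical inputs separate the tree from a proof of the named fact.
[folklore] -/
theorem tate_end_bijective_of_finite_of_saturated
    (hfin : finite_isoClasses_of_finite K (A ⊞ A).dim) (hq : exists_quotient_isogeny (A ⊞ A) ℓ)
    (hfreeP : module_free_tateModule (A ⊞ A) ℓ) (hfinTP : module_finite_tateModule (A ⊞ A) ℓ)
    (hfinT : module_finite_tateModule A ℓ)
    (hss : IsSemisimpleRing ↥(Algebra.adjoin ℚ_[ℓ] (Set.range fun φ : A ⟶ A ↦
      (rationalTateModuleMap ℓ φ : Module.End ℚ_[ℓ] (A.rationalTateModule ℓ)))))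
    (hinj : faltingsTateMap_injective A A)
    (hsat : ∀ (g : Module.End ℤ_[ℓ] (A.tateModule ℓ)) (N : ℤ_[ℓ]), N ≠ 0 →
      N • g ∈ Submodule.span ℤ_[ℓ] (Set.range (tateModuleMap ℓ : (A ⟶ A) → _)) →
      g ∈ Submodule.span ℤ_[ℓ] (Set.range (tateModuleMap ℓ : (A ⟶ A) → _))) :
    tate_end_bijective_of_finite A ℓ := by
  intro _ hℓ
  refine ⟨hinj ℓ hℓ, surjective_faltingsTateMap_of_forall_mem_span ℓ fun g ↦ ?_⟩
  obtain ⟨N, hN0, hN⟩ :=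
    exists_ne_zero_smul_mem_span_of_equivariant_of_finite ℓ hℓ (BinaryBiproduct.bicone A A)
      biprod.total hfin hq hfreeP hfinTP hfinT hss g.toLinearMap
      (fun σ x ↦ Representation.IntertwiningMap.isIntertwining _ _ g σ x)
  exact hsat _ N hN0 hN

end Assembly

end Literature.AlgebraicGeometry.Motives
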